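import Literature.AlgebraicGeometry.HodgeTheory.FermatSectionChartIdeal
import Literature.AlgebraicGeometry.Motives.TensorCentreCartier
import HarnessLib

/-!
# The Fermat coordinate section is an effective Cartier divisor

Topic `Literature/AlgebraicGeometry/HodgeTheory`; theorem-only. The ideal sheaf
`ker (fermatSection k₀ : Xⁿₘ ↪ Xⁿ⁺¹ₘ)` of the coordinate hyperplane section `{x_{k₀} = 0}` of the
standard Fermat hypersurface `Xⁿ⁺¹ₘ ⊂ ℙⁿ⁺²_ℂ` is an **effective Cartier divisor**: on the charts
of `HodgeTheory/FermatSectionChartIdeal` covering the section it is generated by the regular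
function `x_{k₀}/xᵢ`, a nonzerodivisor, and off the section it is the unit ideal
(`Motives/TensorCentreCartier.isEffectiveCartier_of_forall_mem_support`). This is the
transversality input `Xʳₘ = Xʳ⁺¹ₘ · {x_{r+2} = 0}` (and `X⁰ₘ = X¹ₘ · {y₂ = 0}`) of Shioda–Katsura,
Tôhoku Math. J. 31 (1979), §1 (1.1)–(1.4).

## References

* T. Shioda, T. Katsura, On Fermat varieties, Tôhoku Math. J. 31 (1979) 97–115, §1 (1.1)–(1.4).
  [ShiodaKatsura1979]
-/

noncomputable section

open CategoryTheory AlgebraicGeometry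

namespace Literature.AlgebraicGeometry.HodgeTheory

open Literature.AlgebraicGeometry.Motives Literature.AlgebraicGeometry.Resolution

variable {n m : ℕ}

/-- The support of `ker (fermatSection k₀)` is the coordinate hyperplane section `Z_{k₀}`.
[cite: ShiodaKatsura1979, §1 (1.1)] -/
theorem support_ker_fermatSection (hm : m ≠ 0) (k₀ : Fin (n + 3)) :
    ((fermatSection hm k₀).left.ker.support : Set (SmoothHypersurface.hypersurface (fermatPolynomial ℂ (n + 1) m)).left) =
      fermatCoordHyperplane (n + 1) m k₀ := by
  rw [Scheme.Hom.support_ker, (fermatSection hm k₀).left.isClosedEmbedding.isClosed_range.closure_eq,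
    range_fermatSection]

/-- **`ker (fermatSection k₀)` is an effective Cartier divisor on `Xⁿ⁺¹ₘ`** (`m ≥ 1`): the
hyperplane section `{x_{k₀} = 0} ∩ Xⁿ⁺¹ₘ = Xⁿₘ` is cut out, on the charts `Xⁿ⁺¹ₘ ∩ D₊(xᵢ ∂ⱼF)`
covering it, by the single nonzerodivisor `x_{k₀}/xᵢ` (`ker_fermatSection_ideal_chart`,
`appChart_mem_nonZeroDivisors`, `exists_chart_of_mem_fermatCoordHyperplane`).
[cite: ShiodaKatsura1979, §1 (1.1)–(1.4)] -/
theorem isEffectiveCartier_ker_fermatSection (hm : 1 ≤ m) (k₀ : Fin (n + 3)) :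
    IsEffectiveCartier (fermatSection (Nat.one_le_iff_ne_zero.mp hm) k₀).left.ker := by
  refine isEffectiveCartier_of_forall_mem_support _ fun x hx ↦ ?_
  rw [← SetLike.mem_coe, support_ker_fermatSection] at hx
  obtain ⟨i₁, b, j₁, hk, hz⟩ := exists_chart_of_mem_fermatCoordHyperplane hm k₀ hx
  subst hk
  exact ⟨⟨_, isAffineOpen_preimage_chartOpen i₁ b j₁⟩, hz, _, appChart_mem_nonZeroDivisors i₁ b j₁ hm,
    ker_fermatSection_ideal_chart i₁ b j₁ hm⟩

end Literature.AlgebraicGeometry.HodgeTheory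

end
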